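import Summits.QuantumFields.YangMills.Theorems.FemtoTransferGapAdjoint
import HarnessLib

/-!
# The adjoint rotation is a homomorphism `SU(2) → SO(3)`: `Ad(AB) = Ad(A)Ad(B)`, `Ad(A⁻¹) = Ad(A)ᵀ`, `|Ad(A)v| = |v|`
# (lane B of S-BASE, crux `TwistedTraceScaling` stmt-QuantumFields-20203; covariant reformulation of the Laplace step, blueprint §5, brick c2 part i)

Needed for the covariance of the covariant curl `D_{U^g} = Ad(g) D_U Ad(g)⁻¹` (`…CovariantCurl.covCurl`, built from `adRot` of partial holonomies)
and the gauge invariance of the normal-mode data of `D_U†D_U` (hence of the harmonic eigenvalue `Λ(U)`).  Proofs: `vecPart(VUV⁻¹) = Ad(V)·vecPart(U)`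
(`vecPart_conj`) tested on the three unit quaternions `chartSU2 eᵢ` (columns), and `Ad(V)ᵀAd(V) = 1` (`adRot_transpose_mul_self`).
HONEST FRAMING: algebra; femto rung R2b1 (stub of a child of a CONDITIONAL route); not a gap, not Clay.
-/

set_option autoImplicit false

noncomputable section

open scoped Matrix BigOperators
open Literature.MathematicalPhysics.QuantumFieldTheory
open Literature.MathematicalPhysics.QuantumLattice

namespace Summit.QuantumFields.YangMills.Theorems.FemtoTransferGap.TwoLattice.Cov

open Summit.QuantumFields.YangMills.Theorems.FemtoTransferGap

/-- The unit quaternion with vector part `eᵢ` (and `u₀ = 0`). [folklore] -/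
theorem vecPart_chartSU2_single (i : Fin 3) : vecPart (chartSU2 (Pi.single i 1)) = Pi.single i 1 := by
  apply vecPart_chartSU2
  simp [Pi.single_apply]

/-- Columns determine `Ad`: `Ad(V)·eᵢ = vecPart(V · chartSU2(eᵢ) · V⁻¹)`. [folklore] -/
theorem adRot_col (V : SU2) (i : Fin 3) : (adRot V).col i = vecPart (V * chartSU2 (Pi.single i 1) * V⁻¹) := by
  rw [vecPart_conj, vecPart_chartSU2_single, Matrix.mulVec_single_one]

/-- ★ `Ad(AB) = Ad(A)·Ad(B)`. [cite: BrockerTomDieck1985, I (1.10)] -/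
theorem adRot_mul (A B : SU2) : adRot (A * B) = adRot A * adRot B := by
  ext a i
  have hcol : (adRot (A * B)).col i = (adRot A * adRot B).col i := by
    rw [adRot_col, show A * B * chartSU2 (Pi.single i 1) * (A * B)⁻¹ =
      A * (B * chartSU2 (Pi.single i 1) * B⁻¹) * A⁻¹ by group, vecPart_conj, ← adRot_col, Matrix.col]
    funext a
    simp only [Matrix.mulVec, dotProduct, Matrix.mul_apply, Matrix.col_apply, Matrix.transpose_apply]
  exact congrFun hcol a

/-- ★ `Ad(A⁻¹) = Ad(A)ᵀ` (orthogonality + homomorphism). [cite: BrockerTomDieck1985, I (1.10)] -/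
theorem adRot_inv (A : SU2) : adRot A⁻¹ = (adRot A)ᵀ := by
  -- `Ad(1) = 1` (also `…CovariantCurl.adRot_one`; re-derived here from the columns to keep this file independent)
  have h0 : adRot (1 : SU2) = 1 := by
    ext a i
    have hcol : (adRot (1 : SU2)).col i = (1 : Matrix (Fin 3) (Fin 3) ℝ).col i := by
      rw [adRot_col, one_mul, inv_one, mul_one, vecPart_chartSU2_single]
      funext a
      simp only [Matrix.col_apply, Matrix.one_apply, Pi.single_apply]
    exact congrFun hcol a
  have h1 : adRot A⁻¹ * adRot A = 1 := by rw [← adRot_mul, inv_mul_cancel, h0]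
  have h2 : (adRot A)ᵀ * adRot A = 1 := adRot_transpose_mul_self A
  -- right-cancel `adRot A` (invertible since it has a left inverse)
  have hinv : adRot A * (adRot A)ᵀ = 1 := mul_eq_one_comm.mp h2
  calc adRot A⁻¹ = adRot A⁻¹ * (adRot A * (adRot A)ᵀ) := by rw [hinv, mul_one]
    _ = (adRot A⁻¹ * adRot A) * (adRot A)ᵀ := by rw [mul_assoc]
    _ = (adRot A)ᵀ := by rw [h1, one_mul]

/-- `Ad(A) Ad(A)ᵀ = 1` as well. [folklore] -/
theorem adRot_mul_transpose_self (A : SU2) : adRot A * (adRot A)ᵀ = 1 := mul_eq_one_comm.mp (adRot_transpose_mul_self A)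

/-- ★ `Ad(A)` preserves the Euclidean norm: `Σ_a (Ad(A)v)_a² = Σ_a v_a²`. [cite: BrockerTomDieck1985, I (1.10)] -/
theorem sum_sq_adRot_mulVec (A : SU2) (v : Fin 3 → ℝ) : ∑ a, ((adRot A).mulVec v a) ^ 2 = ∑ a, v a ^ 2 := by
  have h : ∀ w : Fin 3 → ℝ, ∑ a, w a ^ 2 = w ⬝ᵥ w := fun w => by simp only [dotProduct, sq]
  rw [h, h, Matrix.dotProduct_mulVec, ← Matrix.mulVec_transpose, Matrix.mulVec_mulVec, adRot_transpose_mul_self, Matrix.one_mulVec]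

end Summit.QuantumFields.YangMills.Theorems.FemtoTransferGap.TwoLattice.Cov

end
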